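import Literature.Probability.Percolation.ArcPivotalSum
import Literature.Probability.Percolation.SepFourAdjGlueProb
import Literature.Probability.Percolation.ArmEventFiveAdjacent
import Literature.Probability.Percolation.FourArmPivotalAltLocalFactor
import Literature.Probability.Percolation.AltFourArmStabilityFromSeparation
import Literature.Probability.Percolation.FiveArmLowerBound
import Literature.Probability.Percolation.NearCriticalOneArmAPriori
import Literature.Probability.Percolation.AltFourArmGlue
import Literature.Probability.Percolation.AltPivotalLowerBound
import Literature.Probability.Percolation.HalfPlaneTwoArmRadiiNearCritical
import Literature.Probability.Percolation.WernerDifferentialInequalities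
import HarnessLib

/-!
# Nolin's Theorem 27 for the adjacent arrangement: stability of the arc-landed four-arm event below `L(p)` (proofs only)

Topic `Literature/Probability/Percolation`; family `crit-perc`. PROOFS ONLY (no definition, no
named fact). Serves the named fact `Literature.Probability.Percolation.Werner2009_lemma63`
(Werner 2009, Lecture 6, **Lemma 6.3**: "`π̂_p(n) ≍ π̂(n)` for `n ≤ L(p)`") for the tree's
ORDER-FREE `π̂_t = fourArmProbAt` (P. Nolin, EJP 13 (2008), Thm. 27 for `σ = BBWW`: "the same is
true for all the arm events … with prescribed colour sequence", here through the arc-landed host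
`E = arcFourArm 0 3 r₀ N` of `ArcLandedFourArm.lean`).

* `arcFourArm_stability_of_altSeparation_of_adjSeparation` — **`P_p(E) ≍ P_{1/2}(E)` below
  `L(p)`**, from two displayed separation inputs: `hsepA` (alternating separation, Nolin Thm. 11
  for `BWBW`, which drives the alternating kernel of the local factors — quasi-multiplicativity
  `altFourArm_quasiMult_of_altSeparation`, the lower bound `altFourArm_lowerBound`, the one-arm
  bound `exists_real_armEvent_one_le_rpow_lt_charLengthW`, `local_factor_alt_le` — and the pivotal
  lower bound `paraPivotalSum_lower_alt_of_altSeparation` for the crossing), and `hsepAdj`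
  (adjacent separation `c P_t(adjFourArmCyc n N) ≤ P_t(sepFourAdj n N)`, Nolin Thm. 11 for `BBWW`,
  which with Kesten's gluing `sepFourAdj_mul_sepFourAdj_mul_glue_le_arc_at`, the typing
  `innerArcFourArm_subset_adjFourArmCyc` / `outerArcFourArm_subset_adjFourArmCyc` and the
  five-arm lower bound `fiveArm_lowerBound` with `armEvent_five_subset_adjFourArmCyc` drives the
  host kernels): Russo + Grönwall (`real_ratio_le_exp_of_pivotal_bound`) on
  `Σ_v P_t(v pivotal for E) ≤ K N² π̂^alt_t P_t(E) ≤ (K/c_P) (d/dt h_t) P_t(E)` (`arcPivotalSum_le`, `ArcPivotalSum.lean`).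
* `Werner2009_lemma63_of_altSeparation_of_adjSeparation` — **the tree's named fact from the two
  separation inputs**, by the sandwich `max(π̂^alt_t, P_t(E)) ≤ π̂_t ≤ π̂^alt_t + P_t(E)/c`
  (`armEvent_four_eq_altFourArm_union_adjFourArmCyc`, `hsepAdj` at `(r₀, N)`,
  `sepFourAdj_subset_arcFourArm`) and the two stabilities
  (`altFourArm_stability_of_altSeparation'` and the theorem above).

## References

* W. Werner, *Lectures on two-dimensional critical percolation*, IAS/Park City Math. Ser. 16
  (2009), Lecture 6, Lemma 6.3 and §5 [WernerPCMI2009].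
* P. Nolin, Near-critical percolation in two dimensions, *Electron. J. Probab.* 13 (2008), Thm. 11,
  Prop. 12, §6.2 Thm. 27 (arXiv 0711.4948: Thm. 10, Prop. 11, Thm. 26) [Nolin2008].
* H. Kesten, Scaling relations for 2D-percolation, *Comm. Math. Phys.* 109 (1987) [KestenScalingCMP1987].
-/

noncomputable section

open MeasureTheory unitInterval Set

namespace Literature.Probability.Percolation

open LatticeModels

set_option maxHeartbeats 1600000 in
/-- **Stability of the arc-landed four-arm event below `L(p)`** (Nolin's Thm. 27 for the
adjacent arrangement through the host `E = arcFourArm 0 3 r₀ N`): from alternating separation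
`hsepA` and adjacent separation `hsepAdj`, for every small `ε` there is `r₁` such that for every
`r₀ ≥ r₁` there are `n₁`, `δ > 0`, `0 < c ≤ C` with `c P_{1/2}(E) ≤ P_t(E) ≤ C P_{1/2}(E)` for all
`1/2 ≤ t < 1/2 + δ`, `n₁ ≤ N`, and `N ≤ L(t, ε)` if `t > 1/2`. [cite: WernerPCMI2009, Lecture 6, Lemma 6.3 and §5] [cite: Nolin2008, Thm. 11, Prop. 12, §6.2 Thm. 27 (arXiv 0711.4948: Thm. 10, Prop. 11, Thm. 26)] -/
theorem arcFourArm_stability_of_altSeparation_of_adjSeparation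
    (hsepA : ∃ ε₁ > (0 : ℝ), ∀ ⦃ε : ℝ⦄, 0 < ε → ε < ε₁ →
      ∃ n₀ : ℕ, ∃ δ > (0 : ℝ), ∃ c > (0 : ℝ),
        ∀ t : unitInterval, 1 / 2 ≤ (t : ℝ) → (t : ℝ) < 1 / 2 + δ →
          ∀ n N : ℕ, n₀ ≤ n → 2 * n ≤ N → (1 / 2 < (t : ℝ) → N ≤ charLengthW ε t) →
            c * altFourArmProbAt t n N ≤ (triSitePercolation t).real (sepFourArm n N))
    (hsepAdj : ∃ ε₁ > (0 : ℝ), ∀ ⦃ε : ℝ⦄, 0 < ε → ε < ε₁ →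
      ∃ n₀ : ℕ, ∃ δ > (0 : ℝ), ∃ c > (0 : ℝ),
        ∀ t : unitInterval, 1 / 2 ≤ (t : ℝ) → (t : ℝ) < 1 / 2 + δ →
          ∀ n N : ℕ, n₀ ≤ n → 2 * n ≤ N → (1 / 2 < (t : ℝ) → N ≤ charLengthW ε t) →
            c * (triSitePercolation t).real (adjFourArmCyc n N) ≤
              (triSitePercolation t).real (sepFourAdj n N)) :
    ∃ ε₁ > (0 : ℝ), ∀ ⦃ε : ℝ⦄, 0 < ε → ε < ε₁ →
      ∃ r₁ : ℕ, ∀ r₀ ≥ r₁, ∃ n₁ : ℕ, ∃ δ > (0 : ℝ), ∃ c > (0 : ℝ), ∃ C : ℝ,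
        ∀ t : unitInterval, 1 / 2 ≤ (t : ℝ) → (t : ℝ) < 1 / 2 + δ →
          ∀ N : ℕ, n₁ ≤ N → (1 / 2 < (t : ℝ) → N ≤ charLengthW ε t) →
            c * (triSitePercolation half).real (arcFourArm 0 3 r₀ N) ≤
                (triSitePercolation t).real (arcFourArm 0 3 r₀ N) ∧
              (triSitePercolation t).real (arcFourArm 0 3 r₀ N) ≤
                C * (triSitePercolation half).real (arcFourArm 0 3 r₀ N) := by
  classical
  have hQM := altFourArm_quasiMult_of_altSeparation hsepA
  have hPS := paraPivotalSum_lower_alt_of_altSeparation hsepA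
  obtain ⟨εQ, hεQ, HQ⟩ := hQM
  obtain ⟨εL, hεL, HL⟩ := altFourArm_lowerBound
  obtain ⟨εH, hεH, HH⟩ := Werner2009_halfPlane_twoArm_holds
  obtain ⟨εP, hεP, HP⟩ := hPS
  obtain ⟨ε5, hε5, H5⟩ := fiveArm_lowerBound
  obtain ⟨εa, hεa, Ha⟩ := hsepAdj
  refine ⟨min (min (min εa εQ) (min εL εH)) (min εP ε5), by positivity, fun ε hε hε₁ => ?_⟩
  have hεa' : ε < εa := hε₁.trans_le ((min_le_left _ _).trans ((min_le_left _ _).trans (min_le_left _ _)))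
  have hεQ' : ε < εQ := hε₁.trans_le ((min_le_left _ _).trans ((min_le_left _ _).trans (min_le_right _ _)))
  have hεL' : ε < εL := hε₁.trans_le ((min_le_left _ _).trans ((min_le_right _ _).trans (min_le_left _ _)))
  have hεH' : ε < εH := hε₁.trans_le ((min_le_left _ _).trans ((min_le_right _ _).trans (min_le_right _ _)))
  have hεP' : ε < εP := hε₁.trans_le ((min_le_right _ _).trans (min_le_left _ _))
  have hε5' : ε < ε5 := hε₁.trans_le ((min_le_right _ _).trans (min_le_right _ _))
  obtain ⟨na, δa, hδa, ca, hca, Hadj⟩ := Ha hε hεa'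
  obtain ⟨rQ, δQ, hδQ, cQ, hcQ, hQ⟩ := HQ hε hεQ'
  obtain ⟨rL, δL, hδL, β₀, hβ₀, cL, hcL, hL⟩ := HL hε hεL'
  obtain ⟨nH, δH, hδH, CH₀, hH⟩ := HH hε hεH'
  obtain ⟨rP, HP⟩ := HP hε hεP'
  obtain ⟨r5, δ5, hδ5, c5, hc5, h5⟩ := H5 hε hε5'
  obtain ⟨CA, α, hCA, hα, hA⟩ := exists_real_armEvent_one_le_rpow_lt_charLengthW hε
  -- RSW below Werner's length and at `1/2`, for the gluing events
  obtain ⟨ε', hε', hε'2, hLen⟩ := charLengthW_le_charLength_of_gt hε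
  obtain ⟨η, hη, -, hRSW⟩ := exists_pow_le_triLRCrossingProb_below hε' hε'2
  obtain ⟨c₀, hc₀, h0⟩ := tri_rsw_half_holds 98 (by norm_num)
  set θ : ℝ := min (η ^ 97) c₀ with hθ
  have hθ0 : 0 < θ := lt_min (pow_pos hη _) hc₀
  set g : ℝ := θ ^ 73 with hg
  have hg0 : 0 < g := pow_pos hθ0 _
  set β : ℝ := min β₀ 1 with hβdef
  have hβ : 0 < β := lt_min hβ₀ one_pos
  have hβ1 : β ≤ 1 := min_le_right _ _
  have hβ2 : β ≤ 2 := hβ1.trans one_le_two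
  have hββ₀ : β ≤ β₀ := min_le_left _ _
  set CH : ℝ := max CH₀ 0 with hCHdef
  have hCH : 0 ≤ CH := le_max_right _ _
  -- the base radius `r` of the local factor and its scale `l₁`
  set r : ℕ := max (max rQ rL) 2 with hrdef
  have hrQr : rQ ≤ r := (le_max_left _ _).trans (le_max_left _ _)
  have hrLr : rL ≤ r := (le_max_right _ _).trans (le_max_left _ _)
  have hr2 : 2 ≤ r := le_max_right _ _
  clear_value r
  set l₁ : ℕ := Nat.log 2 (16 * r + 1) + 1 with hl₁
  have hl₁1 : 1 ≤ l₁ := by omega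
  have hlog : 16 * r + 1 < 2 ^ (Nat.log 2 (16 * r + 1) + 1) := Nat.lt_pow_succ_log_self (by norm_num) _
  have hlog' : 2 ^ Nat.log 2 (16 * r + 1) ≤ 16 * r + 1 := Nat.pow_log_le_self 2 (by omega)
  have hl₁r : 16 * r + 1 ≤ 2 ^ (l₁ + 1) := by
    have : 2 ^ (l₁ + 1) = 2 ^ (Nat.log 2 (16 * r + 1) + 1) * 2 := by rw [hl₁, pow_succ]
    omega
  have hl₁r' : r ≤ 2 ^ (l₁ - 1) := by
    have : l₁ - 1 = Nat.log 2 (16 * r + 1) := by omega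
    rw [this]
    have : 2 ^ (Nat.log 2 (16 * r + 1) + 1) = 2 ^ Nat.log 2 (16 * r + 1) * 2 := by rw [pow_succ]
    omega
  -- the local factor constant
  set Kl : ℝ := 8 / (cQ * cL) * (1 + CA) + CA +
      CA / cQ * (1 + 1 / (cL * ((r : ℝ) / (2 ^ (l₁ - 1) : ℕ)) ^ (2 - β))) *
        ((2 : ℝ) ^ α / ((2 : ℝ) ^ α - 1)) with hKldef
  have h2α : (1 : ℝ) < (2 : ℝ) ^ α := Real.one_lt_rpow (by norm_num) hα
  have hKl : 0 ≤ Kl := by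
    rw [hKldef]
    have : (0 : ℝ) < (2 : ℝ) ^ α - 1 := by linarith
    have hr0 : (0 : ℝ) < r := by exact_mod_cast (show 0 < r by omega)
    positivity
  -- the host constants
  set cH : ℝ := ca * ca * (g ^ 2 * g ^ 2) with hcHdef
  have hcH : 0 < cH := by positivity
  set cE : ℝ := ca * (ca * (c5 / 64)) * (g ^ 2 * g ^ 2) with hcEdef
  have hcE : 0 < cE := by positivity
  refine ⟨max (max (max r na) (max rP r5)) 64, fun r₀ hr₀ => ?_⟩
  have hrr₀ : r ≤ r₀ := le_trans (le_trans (le_max_left _ _) (le_max_left _ _)) (le_trans (le_max_left _ _) hr₀)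
  have hrna : na ≤ r₀ := le_trans (le_trans (le_max_right _ _) (le_max_left _ _)) (le_trans (le_max_left _ _) hr₀)
  have hrP : rP ≤ r₀ := le_trans (le_trans (le_max_left _ _) (le_max_right _ _)) (le_trans (le_max_left _ _) hr₀)
  have hr5 : r5 ≤ r₀ := le_trans (le_trans (le_max_right _ _) (le_max_right _ _)) (le_trans (le_max_left _ _) hr₀)
  have hr64 : 64 ≤ r₀ := le_trans (le_max_right _ _) hr₀
  have hr1 : 1 ≤ r₀ := le_trans (by norm_num) hr64
  have hrL : rL ≤ r₀ := hrLr.trans hrr₀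
  have hrQ : rQ ≤ r₀ := hrQr.trans hrr₀
  clear hr₀
  obtain ⟨nP, δP, hδP, cP, hcP, hP⟩ := HP r₀ hrP
  -- the threshold radius of the host gluing, the pivotal sum
  obtain ⟨rH, hrHdef⟩ : ∃ rH : ℕ, rH = 2 * r₀ + na + 128 := ⟨_, rfl⟩
  obtain ⟨K, hK, N₀, hsum⟩ := arcPivotalSum_le (a := 0) (b := 3) (rH := rH) (n₀ := nH) (l₁ := l₁)
    (CH := CH) (Or.inl ⟨rfl, rfl⟩) hcQ hcL hcH hcE hKl hCH hβ hβ1 hrr₀ hr1 hrL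
  set Kg : ℝ := K / cP with hKgdef
  have hKg0 : 0 ≤ Kg := div_nonneg hK.le hcP.le
  refine ⟨max (max N₀ nP) (2 ^ 20 * r₀), min (min (min δa δQ) (min δL δH)) (min (min δP δ5) (1 / 4)),
    by positivity, Real.exp (-Kg), by positivity, Real.exp Kg, fun p hp1 hp2 N hN hNL => ?_⟩
  have hN₀ : N₀ ≤ N := le_trans (le_trans (le_max_left _ _) (le_max_left _ _)) hN
  have hNP : nP ≤ N := le_trans (le_trans (le_max_right _ _) (le_max_left _ _)) hN
  have hNbig : 2 ^ 20 * r₀ ≤ N := le_trans (le_max_right _ _) hN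
  clear hN
  have hδle : ∀ {x : ℝ}, x < 1 / 2 + min (min (min δa δQ) (min δL δH)) (min (min δP δ5) (1 / 4)) →
      x < 1 / 2 + δa ∧ x < 1 / 2 + δQ ∧ x < 1 / 2 + δL ∧ x < 1 / 2 + δH ∧ x < 1 / 2 + δP ∧
        x < 1 / 2 + δ5 ∧ x < 3 / 4 := by
    intro x hx
    refine ⟨?_, ?_, ?_, ?_, ?_, ?_, ?_⟩ <;>
      linarith [min_le_left (min (min δa δQ) (min δL δH)) (min (min δP δ5) (1 / 4)),
        min_le_right (min (min δa δQ) (min δL δH)) (min (min δP δ5) (1 / 4)),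
        min_le_left (min δa δQ) (min δL δH), min_le_right (min δa δQ) (min δL δH),
        min_le_left δa δQ, min_le_right δa δQ, min_le_left δL δH, min_le_right δL δH,
        min_le_left (min δP δ5) (1 / 4), min_le_right (min δP δ5) (1 / 4),
        min_le_left δP δ5, min_le_right δP δ5]
  set E : Set (SiteConfig (Site 2)) := arcFourArm 0 3 r₀ N with hEdef
  ----------------------------------------------------------------------------------------------
  -- ALL INPUTS AT A PARAMETER `t` WITH `1/2 ≤ t < 1/2 + δ` AND `N ≤ L(t, ε)` IF `t > 1/2`
  ----------------------------------------------------------------------------------------------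
  have hAll : ∀ t : unitInterval, 1 / 2 ≤ (t : ℝ) →
      (t : ℝ) < 1 / 2 + min (min (min δa δQ) (min δL δH)) (min (min δP δ5) (1 / 4)) →
      (1 / 2 < (t : ℝ) → N ≤ charLengthW ε t) →
      ∑ v ∈ triAnnulus r₀ N, (triSitePercolation t).real {ω | IsPivotal E v ω} ≤
          Kg * paraPivotalSum t N * (triSitePercolation t).real E := by
    intro t ht1 ht2 htL
    obtain ⟨htδa, htδQ, htδL, htδH, htδP, htδ5, ht34⟩ := hδle ht2
    have nn : ∀ a b : ℕ, 0 ≤ altFourArmProbAt t a b := fun a b => altFourArmProbAt_nonneg t a b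
    -- (a) kernel quasi-multiplicativity, from the base radius `r`
    have hQt' : ∀ r' R S : ℕ, r ≤ r' → 16 * r' < 4 * R → 4 * R < S → S ≤ N →
        cQ * (altFourArmProbAt t r' R * altFourArmProbAt t (4 * R) S) ≤ altFourArmProbAt t r' S :=
      fun r' R S h0 h1 h2 h3 => hQ t ht1 htδQ r' R S (hrQr.trans h0) h1 h2 fun hgt => h3.trans (htL hgt)
    have hQt : ∀ R S : ℕ, 16 * r₀ < 4 * R → 4 * R < S → S ≤ N →
        cQ * (altFourArmProbAt t r₀ R * altFourArmProbAt t (4 * R) S) ≤ altFourArmProbAt t r₀ S :=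
      fun R S h1 h2 h3 => hQt' r₀ R S hrr₀ h1 h2 h3
    -- (b) kernel lower bound, exponent weakened to `β = min β₀ 1`
    have hLt : ∀ m n : ℕ, rL ≤ m → m ≤ n → n ≤ N →
        cL * ((m : ℝ) / n) ^ (2 - β) ≤ altFourArmProbAt t m n := by
      intro m n h1 h2 h3
      have h := hL t ht1 htδL m n h1 h2 fun hgt => h3.trans (htL hgt)
      refine le_trans (mul_le_mul_of_nonneg_left ?_ hcL.le) h
      rcases Nat.eq_zero_or_pos m with hm | hm
      · subst hm
        simp only [CharP.cast_eq_zero, zero_div]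
        rw [Real.zero_rpow (ne_of_gt (by linarith))]
        exact Real.rpow_nonneg le_rfl _
      · have hn : 0 < n := by omega
        apply Real.rpow_le_rpow_of_exponent_ge
        · exact div_pos (by exact_mod_cast hm) (by exact_mod_cast hn)
        · rw [div_le_one (by exact_mod_cast hn)]; exact_mod_cast h2
        · linarith
    -- (c) the one-arm bound and the local factor
    have hAt : ∀ (c : Bool) (n M : ℕ), 1 ≤ n → n ≤ M → M ≤ N →
        (triSitePercolation t).real (armEvent ![c] n M) ≤ CA * ((n : ℝ) / M) ^ α := by
      intro c n M hn hnM hMN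
      refine hA t c n M ?_ hn hnM fun hne => hMN.trans (htL (lt_of_le_of_ne ht1 (Ne.symm hne)))
      rw [abs_lt]; constructor <;> linarith
    have hLoc : ∀ (c : Bool) (l : ℕ), l₁ + 2 ≤ l → 2 ^ (l + 2) ≤ N →
        altFourArmProbAt t 1 (2 ^ (l - 1)) +
            altFourArmProbAt t 2 (2 ^ l) * (triSitePercolation t).real (armEvent ![c] 2 (2 ^ l)) +
            ∑ l' ∈ Finset.Ico 1 l, altFourArmProbAt t 1 (2 ^ (l' - 1)) *
              (altFourArmProbAt t (2 ^ (l' + 1)) (2 ^ l) *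
                (triSitePercolation t).real (armEvent ![c] (2 ^ (l' + 1)) (2 ^ l))) ≤
          Kl * altFourArmProbAt t r (2 ^ l) := by
      intro c l hl hlN
      have h := local_factor_alt_le (t := t) (N := N) hcQ hcL hCA.le hα hβ hr2 hQt'
        (fun m n hm hmn hnN => hLt m n (hrLr.trans hm) hmn hnN) hAt hl₁1 hl₁r hl₁r' c hl hlN
      rw [hKldef]; exact h
    -- (d) adjacent separation and five arms below `N`
    have adjAt : ∀ n M : ℕ, na ≤ n → 2 * n ≤ M → M ≤ N →
        ca * (triSitePercolation t).real (adjFourArmCyc n M) ≤ (triSitePercolation t).real (sepFourAdj n M) :=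
      fun n M hn h2 hMN => Hadj t ht1 htδa n M hn h2 fun hgt => hMN.trans (htL hgt)
    have fiveAt : ∀ m n : ℕ, r5 ≤ m → m ≤ n → n ≤ N →
        c5 * ((m : ℝ) / n) ^ 2 ≤ (triSitePercolation t).real (armEvent ![true, false, true, false, false] m n) :=
      fun m n h1 h2 h3 => h5 t ht1 htδ5 m n h1 h2 fun hgt => h3.trans (htL hgt)
    -- (e) RSW below `N`, at `t` and at `1 - t`; the gluing events
    have key : ∀ Q : ℕ, 64 * Q < N → ∀ q : unitInterval, (q = t ∨ q = σ t) →
        ∀ w h : ℕ, 1 ≤ h → h ≤ 64 * Q → w ≤ 98 * h → θ ≤ triLRCrossingProb q w h := by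
      intro Q hQN q hq w h h1 hh hw
      have hanti : triLRCrossingProb q (98 * h) h ≤ triLRCrossingProb q w h := triLRCrossingProb_anti_width q hw h
      refine le_trans ?_ hanti
      rcases eq_or_lt_of_le ht1 with heq | hgt
      · have ht : t = half := Subtype.ext (by rw [coe_half]; exact heq.symm)
        have hq' : q = half := by
          rcases hq with rfl | rfl
          · exact ht
          · rw [ht, symm_half]
        have hfl : ⌊(98 : ℝ) * h⌋₊ = 98 * h := by
          have : (98 : ℝ) * h = ((98 * h : ℕ) : ℝ) := by push_cast; ring
          rw [this, Nat.floor_natCast]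
        have := (h0 h (by rw [hfl]; omega)).1
        rw [hfl] at this
        rw [hq']
        exact (min_le_right _ _).trans this
      · have hhL : h < charLength ε' t :=
          lt_of_lt_of_le (by omega : h < N) ((htL hgt).trans (hLen t hgt ht34))
        have hqmin : min t (σ t) ≤ q := by
          rcases hq with rfl | rfl
          · exact min_le_left _ _
          · exact min_le_right _ _
        have := hRSW t q hqmin h h1 hhL 97 (98 * h) (by norm_num) (by omega)
        exact (min_le_left _ _).trans this
    have hG : ∀ Q : ℕ, 1 ≤ Q → 64 * Q < N →
        g ^ 2 * g ^ 2 ≤ (triSitePercolation t).real (fourGlue Q) ^ 2 *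
          (triSitePercolation (σ t)).real (fourGlue Q) ^ 2 := by
      intro Q hQ1 hQN
      obtain ⟨gt, -⟩ := le_real_fourGlue_of_rsw t hQ1 hθ0.le (key Q hQN t (Or.inl rfl))
      obtain ⟨gs, -⟩ := le_real_fourGlue_of_rsw (σ t) hQ1 hθ0.le (key Q hQN (σ t) (Or.inr rfl))
      exact mul_le_mul (pow_le_pow_left₀ hg0.le gt 2) (pow_le_pow_left₀ hg0.le gs 2) (pow_nonneg hg0.le 2)
        (pow_nonneg measureReal_nonneg 2)
    -- the inner piece: `c_a P(innerArc(r₀, m)) ≤ P(sepAdj(r₀, 64q))` for `2 r₀ ≤ 64 q ≤ m`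
    have sIn : ∀ m q : ℕ, 2 * r₀ ≤ 64 * q → 64 * q ≤ m → 64 * q ≤ N →
        ca * (triSitePercolation t).real (innerArcFourArm 0 3 r₀ m) ≤
          (triSitePercolation t).real (sepFourAdj r₀ (64 * q)) := by
      intro m q h2r hqm hqN
      have hrq : r₀ ≤ 64 * q := by omega
      have h1 : (triSitePercolation t).real (innerArcFourArm 0 3 r₀ m) ≤
          (triSitePercolation t).real (adjFourArmCyc r₀ (64 * q)) :=
        (measureReal_mono (innerArcFourArm_anti 0 3 r₀ hrq hqm) (measure_ne_top _ _)).trans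
          (measureReal_mono (innerArcFourArm_subset_adjFourArmCyc (by omega) hrq) (measure_ne_top _ _))
      exact (mul_le_mul_of_nonneg_left h1 hca.le).trans (adjAt r₀ (64 * q) hrna h2r hqN)
    -- the outer piece: `c_a P(outerArc(m', N)) ≤ P(sepAdj(512(q+1), N))` for `m' ≤ 512(q+1)`
    have sOut : ∀ m' q : ℕ, na ≤ 512 * (q + 1) → m' ≤ 512 * (q + 1) → 2 * (512 * (q + 1)) ≤ N →
        ca * (triSitePercolation t).real (outerArcFourArm 0 3 m' N) ≤
          (triSitePercolation t).real (sepFourAdj (512 * (q + 1)) N) := by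
      intro m' q hna hm' hQN
      have hQN' : 512 * (q + 1) ≤ N := le_trans (Nat.le_mul_of_pos_left _ (by norm_num)) hQN
      have h1 : (triSitePercolation t).real (outerArcFourArm 0 3 m' N) ≤
          (triSitePercolation t).real (adjFourArmCyc (512 * (q + 1)) N) :=
        (measureReal_mono (outerArcFourArm_mono_left 0 3 hm' hQN') (measure_ne_top _ _)).trans
          (measureReal_mono (outerArcFourArm_subset_adjFourArmCyc (by omega)) (measure_ne_top _ _))
      exact (mul_le_mul_of_nonneg_left h1 hca.le).trans (adjAt _ N hna hQN le_rfl)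
    -- (f) host gluing: `cH P(innerArc(r₀, m)) P(outerArc(m', N)) ≤ P_t(E)`
    have hHost : ∀ m m' : ℕ, rH ≤ m → m' ≤ 8 * m → 16 * m + 1024 ≤ N →
        cH * ((triSitePercolation t).real (innerArcFourArm 0 3 r₀ m) *
          (triSitePercolation t).real (outerArcFourArm 0 3 m' N)) ≤ (triSitePercolation t).real E := by
      intro m m' hm hm' hmN
      set q : ℕ := m / 64 with hq
      have hdm := Nat.div_add_mod m 64
      have hml := Nat.mod_lt m (by norm_num : 64 > 0)
      have hqm : 64 * q ≤ m := by omega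
      have hmq : m < 64 * (q + 1) := by omega
      have hq1 : 1 ≤ q := by omega
      have hQN' : 1024 * q + 1024 ≤ N := by omega
      have hQN : 2 * (512 * (q + 1)) ≤ N :=
        calc 2 * (512 * (q + 1)) = 1024 * q + 1024 := by ring
          _ ≤ N := hQN'
      have h512N : 512 * (q + 1) ≤ N := le_trans (Nat.le_mul_of_pos_left _ (by norm_num)) hQN
      have h64N : 64 * q ≤ N := by omega
      have h2r : 2 * r₀ ≤ 64 * q := by omega
      have hna' : na ≤ 512 * (q + 1) := by omega
      have hm'' : m' ≤ 512 * (q + 1) := by omega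
      have glue := sepFourAdj_mul_sepFourAdj_mul_glue_le_arc_at t (q := q) (n₁ := r₀) (n₃ := N) hq1 (by omega)
        (by omega) h512N
      have s1 := sIn m q h2r hqm h64N
      have s2 := sOut m' q hna' hm'' hQN
      have hGG := hG q hq1 (by omega)
      calc cH * ((triSitePercolation t).real (innerArcFourArm 0 3 r₀ m) *
            (triSitePercolation t).real (outerArcFourArm 0 3 m' N))
          = (ca * (triSitePercolation t).real (innerArcFourArm 0 3 r₀ m)) *
              (ca * (triSitePercolation t).real (outerArcFourArm 0 3 m' N)) * (g ^ 2 * g ^ 2) := by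
            rw [hcHdef]; ring
        _ ≤ (triSitePercolation t).real (sepFourAdj r₀ (64 * q)) *
              (triSitePercolation t).real (sepFourAdj (512 * (q + 1)) N) *
              ((triSitePercolation t).real (fourGlue q) ^ 2 * (triSitePercolation (σ t)).real (fourGlue q) ^ 2) :=
            mul_le_mul (mul_le_mul s1 s2 (mul_nonneg hca.le measureReal_nonneg) measureReal_nonneg) hGG
              (mul_nonneg (pow_nonneg hg0.le 2) (pow_nonneg hg0.le 2))
              (mul_nonneg measureReal_nonneg measureReal_nonneg)
        _ ≤ (triSitePercolation t).real E := glue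
    -- (g) host extension: `cE P(innerArc(r₀, M)) ≤ P_t(E)` for `N/64 ≤ M ≤ N/16 - 64`
    have hExt : ∀ M : ℕ, N / 64 ≤ M → M ≤ N / 16 - 64 →
        cE * (triSitePercolation t).real (innerArcFourArm 0 3 r₀ M) ≤ (triSitePercolation t).real E := by
      intro M hM1 hM2
      set q : ℕ := M / 64 with hq
      have hdm := Nat.div_add_mod M 64
      have hml := Nat.mod_lt M (by norm_num : 64 > 0)
      have hqM : 64 * q ≤ M := by omega
      have hMq : M < 64 * (q + 1) := by omega
      have hq1 : 1 ≤ q := by omega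
      have hQN' : 1024 * q + 1024 ≤ N := by omega
      have hQN : 2 * (512 * (q + 1)) ≤ N :=
        calc 2 * (512 * (q + 1)) = 1024 * q + 1024 := by ring
          _ ≤ N := hQN'
      have h512N : 512 * (q + 1) ≤ N := le_trans (Nat.le_mul_of_pos_left _ (by norm_num)) hQN
      have h64N : 64 * q ≤ N := by omega
      have h2r : 2 * r₀ ≤ 64 * q := by omega
      have glue := sepFourAdj_mul_sepFourAdj_mul_glue_le_arc_at t (q := q) (n₁ := r₀) (n₃ := N) hq1 (by omega)
        (by omega) h512N
      have s1 := sIn M q h2r hqM h64N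
      -- the outer factor is bounded below through five arms: `P(sepAdj(512(q+1), N)) ≥ c_a c₅ / 64`
      have hNpos : (0 : ℝ) < N := by exact_mod_cast (show 0 < N by omega)
      have hx8 : (1 / 8 : ℝ) ≤ ((512 * (q + 1) : ℕ) : ℝ) / N := by
        rw [le_div_iff₀ hNpos]
        have h' : N ≤ 4096 * q + 4096 := by omega
        have h'' : (N : ℝ) ≤ 4096 * (q : ℝ) + 4096 := by exact_mod_cast h'
        push_cast
        linarith
      have hlow : c5 / 64 ≤ (triSitePercolation t).real (adjFourArmCyc (512 * (q + 1)) N) := by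
        have hr5q : r5 ≤ 512 * (q + 1) := by omega
        have hN1 : 1 ≤ N := by omega
        have h := fiveAt (512 * (q + 1)) N hr5q h512N le_rfl
        have h' := measureReal_mono (armEvent_five_subset_adjFourArmCyc (r := 512 * (q + 1)) (R := N) hN1)
          (measure_ne_top (μ := triSitePercolation t) _)
        refine le_trans ?_ (h.trans h')
        have h2 : ((1 : ℝ) / 8) ^ 2 ≤ (((512 * (q + 1) : ℕ) : ℝ) / N) ^ 2 :=
          pow_le_pow_left₀ (by norm_num) hx8 2
        calc c5 / 64 = c5 * ((1 : ℝ) / 8) ^ 2 := by ring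
          _ ≤ _ := mul_le_mul_of_nonneg_left h2 hc5.le
      have hna' : na ≤ 512 * (q + 1) := by omega
      have s2 : ca * (c5 / 64) ≤ (triSitePercolation t).real (sepFourAdj (512 * (q + 1)) N) :=
        le_trans (mul_le_mul_of_nonneg_left hlow hca.le) (adjAt _ N hna' hQN le_rfl)
      have hGG := hG q hq1 (by omega)
      calc cE * (triSitePercolation t).real (innerArcFourArm 0 3 r₀ M)
          = (ca * (triSitePercolation t).real (innerArcFourArm 0 3 r₀ M)) * (ca * (c5 / 64)) *
              (g ^ 2 * g ^ 2) := by rw [hcEdef]; ring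
        _ ≤ (triSitePercolation t).real (sepFourAdj r₀ (64 * q)) *
              (triSitePercolation t).real (sepFourAdj (512 * (q + 1)) N) *
              ((triSitePercolation t).real (fourGlue q) ^ 2 * (triSitePercolation (σ t)).real (fourGlue q) ^ 2) :=
            mul_le_mul (mul_le_mul s1 s2 (by positivity) measureReal_nonneg) hGG
              (mul_nonneg (pow_nonneg hg0.le 2) (pow_nonneg hg0.le 2))
              (mul_nonneg measureReal_nonneg measureReal_nonneg)
        _ ≤ (triSitePercolation t).real E := glue
    -- (h) the half-plane two-arm bound
    have hHP : ∀ m n : ℕ, nH ≤ m → m ≤ n → n ≤ N →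
        (triSitePercolation t).real (domArmEvent ![true, false] m n upperHalfPlane) ≤ CH * ((m : ℝ) / n) := by
      intro m n h1 h2 h3
      refine (hH t ht1 htδH m n h1 h2 fun hgt => h3.trans (htL hgt)).trans ?_
      exact mul_le_mul_of_nonneg_right (le_max_left _ _) (by positivity)
    -- (i) the pivotal sum and the pivotal lower bound for the crossing
    have hS := hsum t N ht1 ht34.le hN₀ hQt hLt hLoc hHost hExt hHP
    have hpara := hP t ht1 htδP N hNP htL
    refine hS.trans ?_
    have hW0 : 0 ≤ (triSitePercolation t).real E := measureReal_nonneg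
    have h2 : K * ((N : ℝ) ^ 2 * altFourArmProbAt t r₀ N) ≤ Kg * paraPivotalSum t N := by
      rw [hKgdef, div_mul_eq_mul_div, le_div_iff₀ hcP]
      calc K * ((N : ℝ) ^ 2 * altFourArmProbAt t r₀ N) * cP
          = K * (cP * ((N : ℝ) ^ 2 * altFourArmProbAt t r₀ N)) := by ring
        _ ≤ K * paraPivotalSum t N := mul_le_mul_of_nonneg_left hpara hK.le
    exact mul_le_mul_of_nonneg_right h2 hW0
  ----------------------------------------------------------------------------------------------
  -- GRÖNWALL
  ----------------------------------------------------------------------------------------------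
  have hratio : (triSitePercolation p).real E ≤ Real.exp Kg * (triSitePercolation half).real E ∧
      (triSitePercolation half).real E ≤ Real.exp Kg * (triSitePercolation p).real E := by
    rcases eq_or_lt_of_le hp1 with heq | hgt
    · have hp : p = half := Subtype.ext (by rw [coe_half]; exact heq.symm)
      subst hp
      have h1 : (1 : ℝ) ≤ Real.exp Kg := Real.one_le_exp hKg0
      constructor <;> exact le_mul_of_one_le_left measureReal_nonneg h1
    · obtain ⟨-, -, -, -, -, -, hp34⟩ := hδle hp2
      refine real_ratio_le_exp_of_pivotal_bound (N := N) (triAnnulus r₀ N) (determinedBy_arcFourArm (by omega))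
        hgt (by linarith) hKg0 fun t ht htp => ?_
      have htp' : (t : ℝ) < p := Subtype.coe_lt_coe.2 htp
      exact hAll t ht.le (by linarith) fun hgt' => (hNL hgt).trans (charLengthW_antitone hε hgt' htp.le)
  obtain ⟨hr1', hr2'⟩ := hratio
  constructor
  · -- `e^{-Kg} P_{1/2}(E) ≤ P_p(E)`
    calc Real.exp (-Kg) * (triSitePercolation half).real E
        ≤ Real.exp (-Kg) * (Real.exp Kg * (triSitePercolation p).real E) :=
          mul_le_mul_of_nonneg_left hr2' (Real.exp_pos _).le
      _ = (triSitePercolation p).real E := by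
          rw [← mul_assoc, ← Real.exp_add, neg_add_cancel, Real.exp_zero, one_mul]
  · exact hr1'

/-- **The tree's named fact `Werner2009_lemma63` from the two separation inputs** (alternating,
Nolin Thm. 11 for `σ = BWBW`; adjacent, Nolin Thm. 11 for `σ = BBWW`): the order-free four-arm
probability is sandwiched, `max(π̂^alt_s, P_s(E)) ≤ π̂_s(r₀, N) ≤ π̂^alt_s + P_s(E)/c_a`
(`armEvent_four_eq_altFourArm_union_adjFourArmCyc`, `hsepAdj` at `(r₀, N)` and
`sepFourAdj_subset_arcFourArm`), at `s = t` and `s = 1/2`, between two quantities that are stable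
below `L(p)` (`altFourArm_stability_of_altSeparation'`,
`arcFourArm_stability_of_altSeparation_of_adjSeparation`). [cite: WernerPCMI2009, Lecture 6, Lemma 6.3] [cite: Nolin2008, Thm. 11, §6.2 Thm. 27 (arXiv 0711.4948: Thm. 10, Thm. 26)] -/
theorem Werner2009_lemma63_of_altSeparation_of_adjSeparation
    (hsepA : ∃ ε₁ > (0 : ℝ), ∀ ⦃ε : ℝ⦄, 0 < ε → ε < ε₁ →
      ∃ n₀ : ℕ, ∃ δ > (0 : ℝ), ∃ c > (0 : ℝ),
        ∀ t : unitInterval, 1 / 2 ≤ (t : ℝ) → (t : ℝ) < 1 / 2 + δ →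
          ∀ n N : ℕ, n₀ ≤ n → 2 * n ≤ N → (1 / 2 < (t : ℝ) → N ≤ charLengthW ε t) →
            c * altFourArmProbAt t n N ≤ (triSitePercolation t).real (sepFourArm n N))
    (hsepAdj : ∃ ε₁ > (0 : ℝ), ∀ ⦃ε : ℝ⦄, 0 < ε → ε < ε₁ →
      ∃ n₀ : ℕ, ∃ δ > (0 : ℝ), ∃ c > (0 : ℝ),
        ∀ t : unitInterval, 1 / 2 ≤ (t : ℝ) → (t : ℝ) < 1 / 2 + δ →
          ∀ n N : ℕ, n₀ ≤ n → 2 * n ≤ N → (1 / 2 < (t : ℝ) → N ≤ charLengthW ε t) →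
            c * (triSitePercolation t).real (adjFourArmCyc n N) ≤
              (triSitePercolation t).real (sepFourAdj n N)) :
    Werner2009_lemma63 := by
  obtain ⟨εA, hεA, HA⟩ := altFourArm_stability_of_altSeparation' hsepA
  obtain ⟨εE, hεE, HE⟩ := arcFourArm_stability_of_altSeparation_of_adjSeparation hsepA hsepAdj
  obtain ⟨εa, hεa, Ha⟩ := hsepAdj
  refine ⟨min (min εA εE) εa, by positivity, fun ε hε hε₁ => ?_⟩
  have hεA' : ε < εA := hε₁.trans_le ((min_le_left _ _).trans (min_le_left _ _))
  have hεE' : ε < εE := hε₁.trans_le ((min_le_left _ _).trans (min_le_right _ _))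
  have hεa' : ε < εa := hε₁.trans_le (min_le_right _ _)
  obtain ⟨rA, HA⟩ := HA hε hεA'
  obtain ⟨rE, HE⟩ := HE hε hεE'
  obtain ⟨na, δa, hδa, ca, hca, Hadj⟩ := Ha hε hεa'
  refine ⟨max (max rA rE) (max na 4), fun r₀ hr₀ => ?_⟩
  have hrA : rA ≤ r₀ := le_trans (le_trans (le_max_left _ _) (le_max_left _ _)) hr₀
  have hrE : rE ≤ r₀ := le_trans (le_trans (le_max_right _ _) (le_max_left _ _)) hr₀
  have hrna : na ≤ r₀ := le_trans (le_trans (le_max_left _ _) (le_max_right _ _)) hr₀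
  have hr4 : 4 ≤ r₀ := le_trans (le_trans (le_max_right _ _) (le_max_right _ _)) hr₀
  obtain ⟨nA, δA, hδA, cA, hcA, CA, hA⟩ := HA r₀ hrA
  obtain ⟨nE, δE, hδE, cE, hcE, CE, hE⟩ := HE r₀ hrE
  -- the sandwich at a parameter `s`: `π̂_s ≤ π̂^alt_s + P_s(E)/c_a`, `π̂^alt_s ≤ π̂_s`, `P_s(E) ≤ π̂_s`
  have hsand : ∀ (s : unitInterval) (N : ℕ), 1 / 2 ≤ (s : ℝ) → (s : ℝ) < 1 / 2 + δa → 2 * r₀ ≤ N →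
      (1 / 2 < (s : ℝ) → N ≤ charLengthW ε s) →
      fourArmProbAt s r₀ N ≤ altFourArmProbAt s r₀ N + (triSitePercolation s).real (arcFourArm 0 3 r₀ N) / ca ∧
        altFourArmProbAt s r₀ N ≤ fourArmProbAt s r₀ N ∧
        (triSitePercolation s).real (arcFourArm 0 3 r₀ N) ≤ fourArmProbAt s r₀ N := by
    intro s N hs1 hs2 h2N hsL
    have hrN : r₀ ≤ N := by omega
    refine ⟨?_, altFourArmProbAt_le_fourArmProbAt s r₀ N,
      measureReal_mono (arcFourArm_subset_armEvent 0 3 r₀ N) (measure_ne_top _ _)⟩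
    have hsep := Hadj s hs1 hs2 r₀ N hrna h2N hsL
    have hadj : (triSitePercolation s).real (adjFourArmCyc r₀ N) ≤
        (triSitePercolation s).real (arcFourArm 0 3 r₀ N) / ca := by
      rw [le_div_iff₀ hca, mul_comm]
      exact hsep.trans (measureReal_mono (sepFourAdj_subset_arcFourArm hr4 hrN) (measure_ne_top _ _))
    calc fourArmProbAt s r₀ N
        = (triSitePercolation s).real (altFourArm r₀ N ∪ adjFourArmCyc r₀ N) := by
          rw [fourArmProbAt, armEvent_four_eq_altFourArm_union_adjFourArmCyc (by omega) hrN]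
      _ ≤ (triSitePercolation s).real (altFourArm r₀ N) + (triSitePercolation s).real (adjFourArmCyc r₀ N) :=
          measureReal_union_le _ _
      _ ≤ _ := add_le_add le_rfl hadj
  refine ⟨max (max nA nE) (2 * r₀), min (min δA δE) δa, by positivity,
    1 / (1 / cA + 1 / (ca * cE)), by positivity, max CA 0 + max CE 0 / ca, fun t ht1 ht2 N hN hNL => ?_⟩
  have hNA : nA ≤ N := le_trans (le_trans (le_max_left _ _) (le_max_left _ _)) hN
  have hNE : nE ≤ N := le_trans (le_trans (le_max_right _ _) (le_max_left _ _)) hN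
  have h2N : 2 * r₀ ≤ N := le_trans (le_max_right _ _) hN
  have htA : (t : ℝ) < 1 / 2 + δA := by
    linarith [min_le_left (min δA δE) δa, min_le_left δA δE]
  have htE : (t : ℝ) < 1 / 2 + δE := by
    linarith [min_le_left (min δA δE) δa, min_le_right δA δE]
  have hta : (t : ℝ) < 1 / 2 + δa := by linarith [min_le_right (min δA δE) δa]
  obtain ⟨hA1, hA2⟩ := hA t ht1 htA N hNA hNL
  obtain ⟨hE1, hE2⟩ := hE t ht1 htE N hNE hNL
  have hhalf1 : (1 : ℝ) / 2 ≤ (half : ℝ) := by rw [coe_half]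
  have hhalf2 : ((half : unitInterval) : ℝ) < 1 / 2 + δa := by rw [coe_half]; linarith
  obtain ⟨hUt, hLt1, hLt2⟩ := hsand t N ht1 hta h2N hNL
  obtain ⟨hUh, hLh1, hLh2⟩ := hsand half N hhalf1 hhalf2 h2N (fun h => absurd h (by rw [coe_half]; norm_num))
  have hcrit : critFourArmProb r₀ N = fourArmProbAt half r₀ N := (fourArmProbAt_half r₀ N).symm
  set Ft := fourArmProbAt t r₀ N with hFt
  set Fh := fourArmProbAt half r₀ N with hFh
  set At := altFourArmProbAt t r₀ N with hAt'
  set Ah := altFourArmProbAt half r₀ N with hAh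
  set Et := (triSitePercolation t).real (arcFourArm 0 3 r₀ N) with hEt
  set Eh := (triSitePercolation half).real (arcFourArm 0 3 r₀ N) with hEh
  have hAh0 : 0 ≤ Ah := altFourArmProbAt_nonneg _ _ _
  have hEh0 : 0 ≤ Eh := measureReal_nonneg
  have hFt0 : 0 ≤ Ft := fourArmProbAt_nonneg _ _ _
  rw [hcrit]
  constructor
  · -- lower: `F_h ≤ A_h + E_h/c_a ≤ A_t/c_A + E_t/(c_a c_E) ≤ F_t (1/c_A + 1/(c_a c_E))`
    have h1 : Ah ≤ Ft / cA := by
      rw [le_div_iff₀ hcA, mul_comm]; exact hA1.trans hLt1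
    have h2 : Eh / ca ≤ Ft / (ca * cE) := by
      rw [div_le_div_iff₀ hca (mul_pos hca hcE)]
      calc Eh * (ca * cE) = ca * (cE * Eh) := by ring
        _ ≤ ca * Et := mul_le_mul_of_nonneg_left hE1 hca.le
        _ ≤ ca * Ft := mul_le_mul_of_nonneg_left hLt2 hca.le
        _ = Ft * ca := mul_comm _ _
    have h3 : Fh ≤ Ft * (1 / cA + 1 / (ca * cE)) := by
      calc Fh ≤ Ah + Eh / ca := hUh
        _ ≤ Ft / cA + Ft / (ca * cE) := add_le_add h1 h2
        _ = Ft * (1 / cA + 1 / (ca * cE)) := by ring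
    have hpos : 0 < 1 / cA + 1 / (ca * cE) := by positivity
    rw [div_mul_eq_mul_div, one_mul, div_le_iff₀ hpos]
    exact h3
  · -- upper: `F_t ≤ A_t + E_t/c_a ≤ C_A A_h + (C_E/c_a) E_h ≤ (C_A + C_E/c_a) F_h`
    have h1 : At ≤ max CA 0 * Fh :=
      hA2.trans ((mul_le_mul_of_nonneg_right (le_max_left _ _) hAh0).trans
        (mul_le_mul_of_nonneg_left hLh1 (le_max_right _ _)))
    have h2 : Et / ca ≤ max CE 0 / ca * Fh := by
      rw [div_mul_eq_mul_div, div_le_div_iff_of_pos_right hca]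
      exact hE2.trans ((mul_le_mul_of_nonneg_right (le_max_left _ _) hEh0).trans
        (mul_le_mul_of_nonneg_left hLh2 (le_max_right _ _)))
    calc Ft ≤ At + Et / ca := hUt
      _ ≤ max CA 0 * Fh + max CE 0 / ca * Fh := add_le_add h1 h2
      _ = (max CA 0 + max CE 0 / ca) * Fh := by ring

end Literature.Probability.Percolation
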